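import Summits.ResolutionOfSingularities.ResolutionOfSingularities.Theorems.PurelyInseparableDim4ResConeAnnihilatorLift
import HarnessLib

/-!
# Purely inseparable four-folds — the TAME CONE AT A CONSTANT-`(d, e_G)` STEP, XI: PENCIL SPANNING — a family of forms
# cutting out the old vertex lifts, changing ONLY chart coefficients, to a family cutting out the new vertex
# (`Λ = ⟨ℓ₁, ℓ₂⟩ ⇒ Λ′ = ⟨update ℓ₁ j c₁, update ℓ₂ j c₂⟩`; cell `res-dim4-pi`, K2(p) lane, SLICE C letter)

[OURS · counted 0 · AI work weaker than expert review.]  Cell `res-dim4-pi` (D-0157 DOOR 2), K2(p) lower-band lane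
(holder res-dim4-p-12 g2; K lane crit-4 g2, K-A4), seat res-dim4-p-1 g2; desk WORD #75: res-dim4-p-5 g2's named leftover
(i) «pencil spanning `Λ′ = span{update ℓ₁ j c₁, update ℓ₂ j c₂}`».  NOTHING here proves K2(p) = `RidgeBudget.NoAboveFloorTrap p p`,
`NoIsolatedTrap p p` or resolution of singularities in dimension ≥ 4 / characteristic `p`.

Setting (`…ResCone*`): a shade-keeping band step `s →(j, b) s′` (`s′ = CentreBlowup.step q univ j b s`, `b j = 0`,
`q < ord₀ s.F = o < 2q`, `x^{s.r} ∣ s.F`) with CONSTANT vertex dimension `e_G(s′) = e_G(s)`; forms are coefficient vectors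
`φ : Fin 4 → K` acting by `dotProduct`; changing the chart coefficient is `Function.update φ j a`.
res-dim4-p-5 g2's ANNIHILATOR LIFT (p672742) moves ONE form across the step; this file moves a whole CUTTING family:

* **`resVertex_step_iff_update_family`** — if `resVertex s = {w | ∀ a, ℓ a · w = 0}` for a family `ℓ : ι → (Fin 4 → K)`,
  then for some `c : ι → K`, `resVertex s′ = {w | ∀ a, (update (ℓ a) j (c a)) · w = 0}`.  Proof: forward lifts
  (`exists_update_annihilates_step`) give `c`; conversely a vector killed by every lifted form is, after subtracting the
  right multiple of a TRANSVERSAL vector `u ∈ resVertex s′`, `u j ≠ 0` (`not_resVertex_step_le_hyperplane_of_finrank_eq`),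
  a vector of `H_j` killed by the ORIGINAL forms, i.e. of `resVertex s ⊓ H_j = resVertex s′ ⊓ H_j` ((I2),
  `resVertex_step_inf_hyperplane_eq_of_finrank_eq`).  No dimension count and no independence of the family is needed.
* **`resVertex_step_iff_update_pair`** — the `e_G = 2` letter as named by res-dim4-p-5 g2: `Λ = ⟨ℓ₁, ℓ₂⟩` cuts out the old
  vertex ⇒ `Λ′ = ⟨update ℓ₁ j c₁, update ℓ₂ j c₂⟩` cuts out the new one; `resVertex_step_iff_update_single` — the one-form
  case (`e_G = 3`, cf. T-PERSIST p672037).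
* `update_family_unique` — the lifted chart coefficients are UNIQUE (`update_annihilates_step_unique` form by form).

bears_on: LADDER-RESOLUTION:D157-DOOR2 (res-dim4-pi · K2(p) = `RidgeBudget.NoAboveFloorTrap p p`, lower band, SLICE C).
Supports stmt-ResolutionOfSingularities-16155 (helper).
-/

set_option linter.dupNamespace false -- mandated namespace of this single-conjunct summit

noncomputable section

namespace Summit.ResolutionOfSingularities.ResolutionOfSingularities.Theorems.PIDim4

namespace ResCone

open MvPolynomial Finset
open Literature.AlgebraicGeometry.Resolution
open Literature.AlgebraicGeometry.Resolution.CentreBlowup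
open Literature.AlgebraicGeometry.Resolution.Hauser2010
open Literature.AlgebraicGeometry.Resolution.HauserPerlega2019
open PointBlowup (polarMap additiveSubspace direction)

variable {K : Type} [Field K]

/-- On the exceptional hyperplane `H_j = {w_j = 0}` a form and its chart-updated version agree:
`w j = 0 ⇒ (update φ j a)·w = φ·w`. [folklore] -/
theorem dotProduct_update_of_apply_eq_zero (φ : Fin 4 → K) (j : Fin 4) (a : K) {w : Fin 4 → K} (hw : w j = 0) :
    dotProduct (Function.update φ j a) w = dotProduct φ w := by
  rw [dotProduct_update, hw, mul_zero, add_zero]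

section Step

variable [DecidableEq K]

/-- **PENCIL SPANNING, family form.**  At a shade-keeping band step `s →(j, b) s′` with constant vertex dimension
`e_G(s′) = e_G(s)`: if a family of forms `ℓ a` (`a : ι`) CUTS OUT the old vertex (`w ∈ resVertex s ↔ ∀ a, ℓ a · w = 0`),
then after changing only the chart coefficients — `ℓ a ↦ update (ℓ a) j (c a)` — the family cuts out the new vertex.
[OURS] [cite: CossartJannsenSaito2020, Thm. 3.10(4), Thm. 9.3] -/
theorem resVertex_step_iff_update_family {q : ℕ} (j : Fin 4) {b : Fin 4 → K} (hbj : b j = 0) {s : State K}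
    {o : ℕ} (ho : ordZero s.F = o) (hr : ∀ d ∈ s.F.support, s.r ≤ d) (hqo : q < o) (ho2 : o < 2 * q)
    (heq : (CentreBlowup.step q Finset.univ j b s).shade = s.shade)
    (he : Module.finrank K (resVertex (CentreBlowup.step q Finset.univ j b s)) =
      Module.finrank K (resVertex s))
    {ι : Type*} {ℓ : ι → Fin 4 → K} (hV : ∀ w, w ∈ resVertex s ↔ ∀ a, dotProduct (ℓ a) w = 0) :
    ∃ c : ι → K, ∀ w, w ∈ resVertex (CentreBlowup.step q Finset.univ j b s) ↔
      ∀ a, dotProduct (Function.update (ℓ a) j (c a)) w = 0 := by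
  -- forward lifts, form by form
  have hlift : ∀ a, ∃ ca : K, ∀ w ∈ resVertex (CentreBlowup.step q Finset.univ j b s),
      dotProduct (Function.update (ℓ a) j ca) w = 0 := fun a =>
    exists_update_annihilates_step j hbj ho hr hqo ho2 heq (fun w hw => (hV w).mp hw a)
  choose c hc using hlift
  refine ⟨c, fun w => ⟨fun hw a => hc a w hw, fun hw => ?_⟩⟩
  -- a transversal vector of the new vertex
  obtain ⟨u, hu, huj⟩ : ∃ u ∈ resVertex (CentreBlowup.step q Finset.univ j b s), u j ≠ 0 := by
    by_contra h
    push Not at h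
    exact not_resVertex_step_le_hyperplane_of_finrank_eq j hbj ho hr hqo ho2 heq he
      fun u hu => mem_hyperplane.mpr (h u hu)
  -- subtract the right multiple of `u` to land in `H_j`
  set w₀ : Fin 4 → K := w - (w j / u j) • u with hw₀
  have hw₀j : w₀ j = 0 := by
    rw [hw₀, Pi.sub_apply, Pi.smul_apply, smul_eq_mul, div_mul_cancel₀ _ huj, sub_self]
  have hw₀V : w₀ ∈ resVertex s := by
    refine (hV w₀).mpr fun a => ?_
    rw [← dotProduct_update_of_apply_eq_zero (ℓ a) j (c a) hw₀j, hw₀, dotProduct_sub, dotProduct_smul,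
      smul_eq_mul, hw a, hc a u hu, mul_zero, sub_zero]
  have hw₀V' : w₀ ∈ resVertex (CentreBlowup.step q Finset.univ j b s) := by
    have hmem : w₀ ∈ resVertex s ⊓ hyperplane j := Submodule.mem_inf.mpr ⟨hw₀V, mem_hyperplane.mpr hw₀j⟩
    rw [← resVertex_step_inf_hyperplane_eq_of_finrank_eq j hbj ho hr hqo ho2 heq he] at hmem
    exact (Submodule.mem_inf.mp hmem).1
  have hw_eq : w = w₀ + (w j / u j) • u := by rw [hw₀, sub_add_cancel]
  rw [hw_eq]
  exact Submodule.add_mem _ hw₀V' (Submodule.smul_mem _ _ hu)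

/-- **PENCIL SPANNING** (res-dim4-p-5 g2's named letter, `e_G = 2`): at a shade-keeping band step with constant vertex
dimension, if `Λ = ⟨ℓ₁, ℓ₂⟩` cuts out the old vertex (`w ∈ resVertex s ↔ ℓ₁·w = 0 ∧ ℓ₂·w = 0`) then, for suitable chart
coefficients `c₁, c₂`, `Λ′ = ⟨update ℓ₁ j c₁, update ℓ₂ j c₂⟩` cuts out the new vertex. [OURS]
[cite: CossartJannsenSaito2020, Thm. 3.10(4), Thm. 9.3] -/
theorem resVertex_step_iff_update_pair {q : ℕ} (j : Fin 4) {b : Fin 4 → K} (hbj : b j = 0) {s : State K}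
    {o : ℕ} (ho : ordZero s.F = o) (hr : ∀ d ∈ s.F.support, s.r ≤ d) (hqo : q < o) (ho2 : o < 2 * q)
    (heq : (CentreBlowup.step q Finset.univ j b s).shade = s.shade)
    (he : Module.finrank K (resVertex (CentreBlowup.step q Finset.univ j b s)) =
      Module.finrank K (resVertex s))
    {ℓ₁ ℓ₂ : Fin 4 → K} (hV : ∀ w, w ∈ resVertex s ↔ dotProduct ℓ₁ w = 0 ∧ dotProduct ℓ₂ w = 0) :
    ∃ c₁ c₂ : K, ∀ w, w ∈ resVertex (CentreBlowup.step q Finset.univ j b s) ↔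
      dotProduct (Function.update ℓ₁ j c₁) w = 0 ∧ dotProduct (Function.update ℓ₂ j c₂) w = 0 := by
  have hV' : ∀ w, w ∈ resVertex s ↔ ∀ a : Bool, dotProduct ((fun a : Bool => if a then ℓ₁ else ℓ₂) a) w = 0 :=
    fun w => (hV w).trans ⟨fun h a => by cases a <;> simp only [Bool.false_eq_true, ↓reduceIte, h.1, h.2],
      fun h => ⟨by simpa using h true, by simpa using h false⟩⟩
  obtain ⟨c, hc⟩ := resVertex_step_iff_update_family j hbj ho hr hqo ho2 heq he hV'
  refine ⟨c true, c false, fun w => (hc w).trans ⟨fun h => ⟨by simpa using h true, by simpa using h false⟩,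
    fun h a => ?_⟩⟩
  cases a
  · simpa using h.2
  · simpa using h.1

/-- **The one-form case** (`e_G = 3`): if `{ℓ·w = 0}` is the old vertex then `{(update ℓ j c)·w = 0}` is the new one for
a suitable chart coefficient `c` (cf. T-PERSIST, p672037). [OURS] [cite: CossartJannsenSaito2020, Thm. 3.10(4), Thm. 9.3] -/
theorem resVertex_step_iff_update_single {q : ℕ} (j : Fin 4) {b : Fin 4 → K} (hbj : b j = 0) {s : State K}
    {o : ℕ} (ho : ordZero s.F = o) (hr : ∀ d ∈ s.F.support, s.r ≤ d) (hqo : q < o) (ho2 : o < 2 * q)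
    (heq : (CentreBlowup.step q Finset.univ j b s).shade = s.shade)
    (he : Module.finrank K (resVertex (CentreBlowup.step q Finset.univ j b s)) =
      Module.finrank K (resVertex s))
    {ℓ : Fin 4 → K} (hV : ∀ w, w ∈ resVertex s ↔ dotProduct ℓ w = 0) :
    ∃ c : K, ∀ w, w ∈ resVertex (CentreBlowup.step q Finset.univ j b s) ↔
      dotProduct (Function.update ℓ j c) w = 0 := by
  have hV' : ∀ w, w ∈ resVertex s ↔ ∀ _ : Unit, dotProduct ((fun _ : Unit => ℓ) ()) w = 0 :=
    fun w => (hV w).trans ⟨fun h _ => h, fun h => h ()⟩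
  obtain ⟨c, hc⟩ := resVertex_step_iff_update_family j hbj ho hr hqo ho2 heq he hV'
  exact ⟨c (), fun w => (hc w).trans ⟨fun h => h (), fun h _ => h⟩⟩

/-- **The lifted chart coefficients are UNIQUE** (constant `e_G`): if two updated families both KILL the new vertex, their
chart coefficients agree form by form (`update_annihilates_step_unique`). [OURS] [cite: CossartJannsenSaito2020, Thm. 3.10(4)] -/
theorem update_family_unique {q : ℕ} (j : Fin 4) {b : Fin 4 → K} (hbj : b j = 0) {s : State K}
    {o : ℕ} (ho : ordZero s.F = o) (hr : ∀ d ∈ s.F.support, s.r ≤ d) (hqo : q < o) (ho2 : o < 2 * q)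
    (heq : (CentreBlowup.step q Finset.univ j b s).shade = s.shade)
    (he : Module.finrank K (resVertex (CentreBlowup.step q Finset.univ j b s)) =
      Module.finrank K (resVertex s))
    {ι : Type*} {ℓ : ι → Fin 4 → K} {c c' : ι → K}
    (hc : ∀ a, ∀ w ∈ resVertex (CentreBlowup.step q Finset.univ j b s),
      dotProduct (Function.update (ℓ a) j (c a)) w = 0)
    (hc' : ∀ a, ∀ w ∈ resVertex (CentreBlowup.step q Finset.univ j b s),
      dotProduct (Function.update (ℓ a) j (c' a)) w = 0) :
    c = c' :=
  funext fun a => update_annihilates_step_unique j hbj ho hr hqo ho2 heq he (hc a) (hc' a)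

end Step

end ResCone

end Summit.ResolutionOfSingularities.ResolutionOfSingularities.Theorems.PIDim4

end
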